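import Summits.MatrixMultiplication.OmegaCensus.DominoUniformZ4Z4
import Summits.MatrixMultiplication.OmegaCensus.DihedralLawModOneZ4Z4
import Summits.MatrixMultiplication.OmegaCensus.CubePartThreeZ4Z4
import Summits.MatrixMultiplication.OmegaCensus.DicyclicLaw512
import HarnessLib

/-!
# Consequences of the uniform domino theorem over `A ↠ ℤ₄ × ℤ₄`: all domino cells, the orders `1024` and `2048`

ω-census `pub-omega`, family (b3), seat pub-omega-group gen 16.  Framing: lottery ticket; floor = certified bounds/negative
ranges.  VALUE: kernel theorems about the group-theoretic method (TPP capacity of dihedral-like / dicyclic-type groups);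
NOT progress on ω.

From `no_shifted_form_of_onto_z4z4` (`DominoUniformZ4Z4.lean`, every size):
* **`no_law_domino_of_onto_z4z4`** — dihedral-like `G` over a finite abelian `A ↠ ℤ₄²` (any `c₀`): NO TPP triple with
  coset parts `(1,1 | d,d | e,e)` attains `3|S||T||U| + 8 = 8|A|`, for ALL `d, e` (the whole domino column of the Dih
  classification for `ℤ₄²`-quotients; gens 14–16 had `d ∈ {1, 3, 5, 7, 9}`); cell form `no_law_cube_one_of_onto_z4z4`.
* **`no_mod_one_law_of_onto_z4z4_domino`** — hence no law at all over `A ↠ ℤ₄²` whenever every factorisation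
  `cde = (|A|−1)/3` has a part `1` or two parts `3` (e.g. `(|A|−1)/3` prime, a product of two primes, or `9p`).
* The ORDER `1024` (`341 = 11·31`): `no_mod_one_law_card_1024_of_onto_z4z4`, instances `no_mod_one_law_z4_z256`,
  `no_mod_one_law_z8_z128`, `no_mod_one_law_z16_z64`, `no_mod_one_law_z32_z32` — with `no_mod_one_law_of_rank_three` and the
  attained cyclic / index-`2`-cyclic cases, the Dih law is now kernel-decided for every abelian `2`-group `A` with `|A| ≤ 1024`.
* The ORDER `2048`, dicyclic type (`no_dicyclic_law_of_onto_z4z4_of_dih` of `DicyclicLaw512.lean` with the Dih input at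
  `1024`): **`no_dicyclic_law_card_2048_of_onto_z4z4`**, instances `z32_z64_dicyclic_no_law_16_0`, `z32_z64_dicyclic_no_law_0_32`,
  `z2_z32_z32_dicyclic_no_law` — the dicyclic law is kernel-decided for every abelian `2`-group `A` with `|A| ≤ 2048`.
-/

namespace Summit.MatrixMultiplication.OmegaCensus

open Finset

section DihedralLike

variable {A : Type} [AddCommGroup A] [DecidableEq A] [Fintype A] {G : Type} [Group G] [DecidableEq G]
  {ρ τ : A → G} {c₀ : A} {S T U : Finset G}

open Literature.Combinatorics.Additive

/-- **No domino law triple over `A ↠ ℤ₄ × ℤ₄`, any part sizes.**  Dihedral-like `G` over `A` (any `c₀`),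
`φ : A →+ ZMod 4 × ZMod 4` onto; a TPP triple with `|S₀| = |S₁| = 1`, `|T₀| = |T₁|`, `|U₀| = |U₁|`.  Then
`3|S||T||U| + 8 ≠ 8|A|`. [folklore] -/
theorem no_law_domino_of_onto_z4z4
    (hρρ : ∀ a b, ρ a * ρ b = ρ (a + b)) (hρτ : ∀ a b, ρ a * τ b = τ (b - a))
    (hτρ : ∀ a b, τ a * ρ b = τ (a + b)) (hττ : ∀ a b, τ a * τ b = ρ (c₀ + b - a))
    (hρ : Function.Injective ρ) (hτ : Function.Injective τ) (hne : ∀ a b, ρ a ≠ τ b)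
    (hsurj : ∀ g, (∃ a, ρ a = g) ∨ (∃ a, τ a = g))
    (φ : A →+ ZMod 4 × ZMod 4) (hφ : Function.Surjective φ)
    (h : TripleProductProperty S T U)
    (hS₀ : (univ.filter fun a : A => ρ a ∈ S).card = 1) (hS₁ : (univ.filter fun a : A => τ a ∈ S).card = 1)
    (hT : (univ.filter fun a : A => ρ a ∈ T).card = (univ.filter fun a : A => τ a ∈ T).card)
    (hU : (univ.filter fun a : A => ρ a ∈ U).card = (univ.filter fun a : A => τ a ∈ U).card)
    (hV : 3 * (S.card * T.card * U.card) + 8 = 8 * Fintype.card A) : False := by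
  classical
  obtain ⟨X, Y, β, γ, x₀, -, -, hinj, hPQ, hPR, hQR, hcover⟩ :=
    domino_shifted_form_of_law hρρ hρτ hτρ hττ hρ hτ hne hsurj h hS₀ hS₁ hT hU hV
  exact no_shifted_form_of_onto_z4z4 φ hφ hinj hPQ hPR hQR hcover

/-- **Cell form**: balanced coset parts and some `ρ`-part of size `1` (in any member) ⇒ `3|S||T||U| + 8 ≠ 8|A|` over
`A ↠ ℤ₄ × ℤ₄`. [folklore] -/
theorem no_law_cube_one_of_onto_z4z4
    (hρρ : ∀ a b, ρ a * ρ b = ρ (a + b)) (hρτ : ∀ a b, ρ a * τ b = τ (b - a))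
    (hτρ : ∀ a b, τ a * ρ b = τ (a + b)) (hττ : ∀ a b, τ a * τ b = ρ (c₀ + b - a))
    (hρ : Function.Injective ρ) (hτ : Function.Injective τ) (hne : ∀ a b, ρ a ≠ τ b)
    (hsurj : ∀ g, (∃ a, ρ a = g) ∨ (∃ a, τ a = g))
    (φ : A →+ ZMod 4 × ZMod 4) (hφ : Function.Surjective φ)
    (h : TripleProductProperty S T U)
    (hS : (univ.filter fun a : A => ρ a ∈ S).card = (univ.filter fun a : A => τ a ∈ S).card)
    (hT : (univ.filter fun a : A => ρ a ∈ T).card = (univ.filter fun a : A => τ a ∈ T).card)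
    (hU : (univ.filter fun a : A => ρ a ∈ U).card = (univ.filter fun a : A => τ a ∈ U).card)
    (h1 : (univ.filter fun a : A => ρ a ∈ S).card = 1 ∨ (univ.filter fun a : A => ρ a ∈ T).card = 1 ∨
      (univ.filter fun a : A => ρ a ∈ U).card = 1) :
    3 * (S.card * T.card * U.card) + 8 ≠ 8 * Fintype.card A := by
  intro hV
  rcases h1 with hs1 | ht1 | hu1
  · exact no_law_domino_of_onto_z4z4 hρρ hρτ hτρ hττ hρ hτ hne hsurj φ hφ h hs1 (hS ▸ hs1) hT hU hV
  · exact no_law_domino_of_onto_z4z4 hρρ hρτ hτρ hττ hρ hτ hne hsurj φ hφ h.rotate ht1 (hT ▸ ht1) hU hS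
      (by rw [show T.card * U.card * S.card = S.card * T.card * U.card by ring]; exact hV)
  · exact no_law_domino_of_onto_z4z4 hρρ hρτ hτρ hττ hρ hτ hne hsurj φ hφ h.rotate.rotate hu1 (hU ▸ hu1) hS hT
      (by rw [show U.card * S.card * T.card = S.card * T.card * U.card by ring]; exact hV)

/-- **No `|A| ≡ 1 (mod 3)` law over `A ↠ ℤ₄ × ℤ₄` unless `(|A|−1)/3` is a product of three factors `≥ 2` other than
`3·3·e`**: if every factorisation `cde = (|A| − 1)/3` has a part `1` or two parts `3`, then no dihedral-like group over `A`
(any `c₀`) has a TPP triple attaining `3|S||T||U| + 8 = 8|A|`. [folklore] -/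
theorem no_mod_one_law_of_onto_z4z4_domino
    (hρρ : ∀ a b, ρ a * ρ b = ρ (a + b)) (hρτ : ∀ a b, ρ a * τ b = τ (b - a))
    (hτρ : ∀ a b, τ a * ρ b = τ (a + b)) (hττ : ∀ a b, τ a * τ b = ρ (c₀ + b - a))
    (hρ : Function.Injective ρ) (hτ : Function.Injective τ) (hne : ∀ a b, ρ a ≠ τ b)
    (hsurj : ∀ g, (∃ a, ρ a = g) ∨ (∃ a, τ a = g)) (hA : 14 ≤ Fintype.card A)
    (φ : A →+ ZMod 4 × ZMod 4) (hφ : Function.Surjective φ)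
    (hq : ∀ c d e : ℕ, 3 * (c * d * e) + 1 = Fintype.card A →
      (c = 1 ∨ d = 1 ∨ e = 1) ∨ ((c = 3 ∧ d = 3) ∨ (d = 3 ∧ e = 3) ∨ (c = 3 ∧ e = 3)))
    (h : TripleProductProperty S T U) : 3 * (S.card * T.card * U.card) + 8 ≠ 8 * Fintype.card A := by
  intro hV
  have hmod : Fintype.card A % 3 = 1 := by omega
  by_cases hnc : ((univ.filter fun a : A => ρ a ∈ S).card = (univ.filter fun a : A => τ a ∈ S).card ∧
      (univ.filter fun a : A => ρ a ∈ T).card = (univ.filter fun a : A => τ a ∈ T).card ∧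
      (univ.filter fun a : A => ρ a ∈ U).card = (univ.filter fun a : A => τ a ∈ U).card)
  · obtain ⟨hS', hT', hU'⟩ := hnc
    have cS := card_eq_parts' hρ hτ hne hsurj S
    have cT := card_eq_parts' hρ hτ hne hsurj T
    have cU := card_eq_parts' hρ hτ hne hsurj U
    set s₀ := (univ.filter fun a : A => ρ a ∈ S).card with hs₀
    set t₀ := (univ.filter fun a : A => ρ a ∈ T).card with ht₀
    set u₀ := (univ.filter fun a : A => ρ a ∈ U).card with hu₀
    have eS : S.card = 2 * s₀ := by rw [cS, ← hS']; ring
    have eT : T.card = 2 * t₀ := by rw [cT, ← hT']; ring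
    have eU : U.card = 2 * u₀ := by rw [cU, ← hU']; ring
    have hprod : 3 * (s₀ * t₀ * u₀) + 1 = Fintype.card A := by
      rw [eS, eT, eU] at hV; nlinarith
    rcases hq s₀ t₀ u₀ hprod with h1 | ⟨h3, h3'⟩ | ⟨h3, h3'⟩ | ⟨h3, h3'⟩
    · exact no_law_cube_one_of_onto_z4z4 hρρ hρτ hτρ hττ hρ hτ hne hsurj φ hφ h hS' hT' hU' h1 hV
    · exact no_law_cube_33e_of_onto_z4z4 hρρ hρτ hτρ hττ hρ hτ hne hsurj φ hφ h h3 (hS' ▸ h3) h3' (hT' ▸ h3') hU' hV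
    · exact no_law_cube_e33_of_onto_z4z4 hρρ hρτ hτρ hττ hρ hτ hne hsurj φ hφ h hS' h3 (hT' ▸ h3) h3' (hU' ▸ h3') hV
    · exact no_law_cube_3e3_of_onto_z4z4 hρρ hρτ hτρ hττ hρ hτ hne hsurj φ hφ h h3 (hS' ▸ h3) hT' h3' (hU' ▸ h3') hV
  · obtain ⟨g, a, b, hab⟩ :=
      two_cosets_of_mod_one_law_of_not_cube hρρ hρτ hτρ hττ hρ hτ hne hsurj hmod hA h hV hnc
    exact not_two_cosets_of_onto_z4z4 φ hφ g a b hab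

/-- `cde = 341 = 11·31`: some part is `1`. [folklore] -/
theorem cube_factor_of_1024 {c d e : ℕ} (h : 3 * (c * d * e) + 1 = 1024) :
    (c = 1 ∨ d = 1 ∨ e = 1) ∨ ((c = 3 ∧ d = 3) ∨ (d = 3 ∧ e = 3) ∨ (c = 3 ∧ e = 3)) := by
  have hcde : c * (d * e) = 341 := by rw [← mul_assoc]; omega
  have hc : c ∈ Nat.divisors 341 := Nat.mem_divisors.2 ⟨Dvd.intro _ hcde, by norm_num⟩
  have hd : d ∈ Nat.divisors 341 :=
    Nat.mem_divisors.2 ⟨Dvd.intro (c * e) (by rw [← hcde]; ring), by norm_num⟩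
  rw [show Nat.divisors 341 = {1, 11, 31, 341} from by decide] at hc hd
  simp only [Finset.mem_insert, Finset.mem_singleton] at hc hd
  rcases hc with rfl | rfl | rfl | rfl <;> rcases hd with rfl | rfl | rfl | rfl <;> omega

/-- **`|A| = 1024`, `A ↠ ℤ₄ × ℤ₄` (`ℤ₄×ℤ₂₅₆`, `ℤ₈×ℤ₁₂₈`, `ℤ₁₆×ℤ₆₄`, `ℤ₃₂²` and every `2`-rank-`≥ 3` group containing `ℤ₄²`):
no dihedral-like group over `A` (any `c₀`) attains `3|S||T||U| + 8 = 8|A|`** (`(1024−1)/3 = 341 = 11·31`). [folklore] -/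
theorem no_mod_one_law_card_1024_of_onto_z4z4
    (hρρ : ∀ a b, ρ a * ρ b = ρ (a + b)) (hρτ : ∀ a b, ρ a * τ b = τ (b - a))
    (hτρ : ∀ a b, τ a * ρ b = τ (a + b)) (hττ : ∀ a b, τ a * τ b = ρ (c₀ + b - a))
    (hρ : Function.Injective ρ) (hτ : Function.Injective τ) (hne : ∀ a b, ρ a ≠ τ b)
    (hsurj : ∀ g, (∃ a, ρ a = g) ∨ (∃ a, τ a = g)) (hA : Fintype.card A = 1024)
    (φ : A →+ ZMod 4 × ZMod 4) (hφ : Function.Surjective φ) (h : TripleProductProperty S T U) :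
    3 * (S.card * T.card * U.card) + 8 ≠ 8 * Fintype.card A :=
  no_mod_one_law_of_onto_z4z4_domino hρρ hρτ hτρ hττ hρ hτ hne hsurj (by rw [hA]; norm_num) φ hφ
    (fun c d e hcde => cube_factor_of_1024 (by rw [hcde, hA])) h

/-- **The dicyclic law at `|A| = 2048` is not attained when `A/⟨c₀⟩ ↠ ℤ₄ × ℤ₄`** (dicyclic type, `c₀ ≠ 0`, `Φ c₀ = 0`; the
Dih input at `1024` is `no_mod_one_law_card_1024_of_onto_z4z4`). [folklore] -/
theorem no_dicyclic_law_card_2048_of_onto_z4z4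
    (hρρ : ∀ a b, ρ a * ρ b = ρ (a + b)) (hρτ : ∀ a b, ρ a * τ b = τ (b - a))
    (hτρ : ∀ a b, τ a * ρ b = τ (a + b)) (hττ : ∀ a b, τ a * τ b = ρ (c₀ + b - a)) (hc₀ : c₀ ≠ 0)
    (hρ : Function.Injective ρ) (hτ : Function.Injective τ) (hne : ∀ a b, ρ a ≠ τ b)
    (hsurj : ∀ g, (∃ a, ρ a = g) ∨ (∃ a, τ a = g)) (hA : Fintype.card A = 2048)
    (Φ : A →+ ZMod 4 × ZMod 4) (hΦ : Function.Surjective Φ) (hΦc : Φ c₀ = 0)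
    (h : TripleProductProperty S T U) :
    3 * (S.card * T.card * U.card) + 16 ≠ 8 * Fintype.card A :=
  no_dicyclic_law_of_onto_z4z4_of_dih hρρ hρτ hτρ hττ hc₀ hρ hτ hne hsurj (n := 1024) (by rw [hA])
    (fun _ _ _ _ _ _ _ _ _ _ h₁ h₂ h₃ h₄ h₅ h₆ h₇ h₈ hB φ hφ _ _ _ hT =>
      no_mod_one_law_card_1024_of_onto_z4z4 h₁ h₂ h₃ h₄ h₅ h₆ h₇ h₈ hB φ hφ hT)
    (k := 11) (fun a => by rw [show (2 ^ 11 : ℕ) = Fintype.card A by rw [hA]; norm_num, card_nsmul_eq_zero]) Φ hΦ hΦc h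

end DihedralLike

/-! ## Instances -/

section Instances

variable {G : Type} [Group G] [DecidableEq G] {S T U : Finset G}

open Literature.Combinatorics.Additive

/-- **`ℤ₄ × ℤ₂₅₆`: no dihedral-like group over it (any `c₀`; `c₀ = 0` is `Dih`) has a TPP triple with
`3|S||T||U| + 8 = 8 · 1024`.** [folklore] -/
theorem no_mod_one_law_z4_z256 {ρ τ : ZMod 4 × ZMod 256 → G} {c₀ : ZMod 4 × ZMod 256}
    (hρρ : ∀ a b, ρ a * ρ b = ρ (a + b)) (hρτ : ∀ a b, ρ a * τ b = τ (b - a))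
    (hτρ : ∀ a b, τ a * ρ b = τ (a + b)) (hττ : ∀ a b, τ a * τ b = ρ (c₀ + b - a))
    (hρ : Function.Injective ρ) (hτ : Function.Injective τ) (hne : ∀ a b, ρ a ≠ τ b)
    (hsurj : ∀ g, (∃ a, ρ a = g) ∨ (∃ a, τ a = g)) (h : TripleProductProperty S T U) :
    3 * (S.card * T.card * U.card) + 8 ≠ 8 * Fintype.card (ZMod 4 × ZMod 256) :=
  no_mod_one_law_card_1024_of_onto_z4z4 hρρ hρτ hτρ hττ hρ hτ hne hsurj (by simp) _
    (zm_zn_onto_z4z4 (by norm_num) (by norm_num)) h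

/-- **`ℤ₈ × ℤ₁₂₈`**: no law `3V + 8 = 8 · 1024` in any dihedral-like group over it. [folklore] -/
theorem no_mod_one_law_z8_z128 {ρ τ : ZMod 8 × ZMod 128 → G} {c₀ : ZMod 8 × ZMod 128}
    (hρρ : ∀ a b, ρ a * ρ b = ρ (a + b)) (hρτ : ∀ a b, ρ a * τ b = τ (b - a))
    (hτρ : ∀ a b, τ a * ρ b = τ (a + b)) (hττ : ∀ a b, τ a * τ b = ρ (c₀ + b - a))
    (hρ : Function.Injective ρ) (hτ : Function.Injective τ) (hne : ∀ a b, ρ a ≠ τ b)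
    (hsurj : ∀ g, (∃ a, ρ a = g) ∨ (∃ a, τ a = g)) (h : TripleProductProperty S T U) :
    3 * (S.card * T.card * U.card) + 8 ≠ 8 * Fintype.card (ZMod 8 × ZMod 128) :=
  no_mod_one_law_card_1024_of_onto_z4z4 hρρ hρτ hτρ hττ hρ hτ hne hsurj (by simp) _
    (zm_zn_onto_z4z4 (by norm_num) (by norm_num)) h

/-- **`ℤ₁₆ × ℤ₆₄`**: no law `3V + 8 = 8 · 1024` in any dihedral-like group over it. [folklore] -/
theorem no_mod_one_law_z16_z64 {ρ τ : ZMod 16 × ZMod 64 → G} {c₀ : ZMod 16 × ZMod 64}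
    (hρρ : ∀ a b, ρ a * ρ b = ρ (a + b)) (hρτ : ∀ a b, ρ a * τ b = τ (b - a))
    (hτρ : ∀ a b, τ a * ρ b = τ (a + b)) (hττ : ∀ a b, τ a * τ b = ρ (c₀ + b - a))
    (hρ : Function.Injective ρ) (hτ : Function.Injective τ) (hne : ∀ a b, ρ a ≠ τ b)
    (hsurj : ∀ g, (∃ a, ρ a = g) ∨ (∃ a, τ a = g)) (h : TripleProductProperty S T U) :
    3 * (S.card * T.card * U.card) + 8 ≠ 8 * Fintype.card (ZMod 16 × ZMod 64) :=
  no_mod_one_law_card_1024_of_onto_z4z4 hρρ hρτ hτρ hττ hρ hτ hne hsurj (by simp) _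
    (zm_zn_onto_z4z4 (by norm_num) (by norm_num)) h

/-- **`ℤ₃₂ × ℤ₃₂`**: no law `3V + 8 = 8 · 1024` in any dihedral-like group over it. [folklore] -/
theorem no_mod_one_law_z32_z32 {ρ τ : ZMod 32 × ZMod 32 → G} {c₀ : ZMod 32 × ZMod 32}
    (hρρ : ∀ a b, ρ a * ρ b = ρ (a + b)) (hρτ : ∀ a b, ρ a * τ b = τ (b - a))
    (hτρ : ∀ a b, τ a * ρ b = τ (a + b)) (hττ : ∀ a b, τ a * τ b = ρ (c₀ + b - a))
    (hρ : Function.Injective ρ) (hτ : Function.Injective τ) (hne : ∀ a b, ρ a ≠ τ b)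
    (hsurj : ∀ g, (∃ a, ρ a = g) ∨ (∃ a, τ a = g)) (h : TripleProductProperty S T U) :
    3 * (S.card * T.card * U.card) + 8 ≠ 8 * Fintype.card (ZMod 32 × ZMod 32) :=
  no_mod_one_law_card_1024_of_onto_z4z4 hρρ hρτ hτρ hττ hρ hτ hne hsurj (by simp) _
    (zm_zn_onto_z4z4 (by norm_num) (by norm_num)) h

/-- **`G(ℤ₃₂ × ℤ₆₄, (16,0))` (`A/⟨c₀⟩ ≅ ℤ₁₆ × ℤ₆₄`, a group of order `4096`): the dicyclic law `3V + 16 = 8·2048` is not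
attained.** [folklore] -/
theorem z32_z64_dicyclic_no_law_16_0 [Fact (((16, 0) : ZMod 32 × ZMod 64) + (16, 0) = 0)]
    (S T U : Finset (DihedralLikeGroup (ZMod 32 × ZMod 64) (16, 0)))
    (h : Literature.Combinatorics.Additive.TripleProductProperty S T U) :
    3 * (S.card * T.card * U.card) + 16 ≠ 8 * Fintype.card (ZMod 32 × ZMod 64) :=
  no_dicyclic_law_card_2048_of_onto_z4z4 (A := ZMod 32 × ZMod 64) (c₀ := (16, 0))
    DihedralLikeGroup.rho_mul_rho DihedralLikeGroup.rho_mul_tau DihedralLikeGroup.tau_mul_rho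
    DihedralLikeGroup.tau_mul_tau (by decide) DihedralLikeGroup.rho_injective DihedralLikeGroup.tau_injective
    DihedralLikeGroup.rho_ne_tau DihedralLikeGroup.rho_or_tau (by simp)
    _ (zm_zn_onto_z4z4 (by norm_num) (by norm_num)) (by decide) h

/-- **`G(ℤ₃₂ × ℤ₆₄, (0,32))` (`A/⟨c₀⟩ ≅ ℤ₃₂²`): the dicyclic law is not attained.** [folklore] -/
theorem z32_z64_dicyclic_no_law_0_32 [Fact (((0, 32) : ZMod 32 × ZMod 64) + (0, 32) = 0)]
    (S T U : Finset (DihedralLikeGroup (ZMod 32 × ZMod 64) (0, 32)))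
    (h : Literature.Combinatorics.Additive.TripleProductProperty S T U) :
    3 * (S.card * T.card * U.card) + 16 ≠ 8 * Fintype.card (ZMod 32 × ZMod 64) :=
  no_dicyclic_law_card_2048_of_onto_z4z4 (A := ZMod 32 × ZMod 64) (c₀ := (0, 32))
    DihedralLikeGroup.rho_mul_rho DihedralLikeGroup.rho_mul_tau DihedralLikeGroup.tau_mul_rho
    DihedralLikeGroup.tau_mul_tau (by decide) DihedralLikeGroup.rho_injective DihedralLikeGroup.tau_injective
    DihedralLikeGroup.rho_ne_tau DihedralLikeGroup.rho_or_tau (by simp)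
    _ (zm_zn_onto_z4z4 (by norm_num) (by norm_num)) (by decide) h

/-- **`G(ℤ₂ × ℤ₃₂ × ℤ₃₂, (1,0,0))` (`A/⟨c₀⟩ ≅ ℤ₃₂²`, split): the dicyclic law is not attained.** [folklore] -/
theorem z2_z32_z32_dicyclic_no_law [Fact (((1, 0, 0) : ZMod 2 × ZMod 32 × ZMod 32) + (1, 0, 0) = 0)]
    (S T U : Finset (DihedralLikeGroup (ZMod 2 × ZMod 32 × ZMod 32) (1, 0, 0)))
    (h : Literature.Combinatorics.Additive.TripleProductProperty S T U) :
    3 * (S.card * T.card * U.card) + 16 ≠ 8 * Fintype.card (ZMod 2 × ZMod 32 × ZMod 32) :=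
  no_dicyclic_law_card_2048_of_onto_z4z4 (A := ZMod 2 × ZMod 32 × ZMod 32) (c₀ := (1, 0, 0))
    DihedralLikeGroup.rho_mul_rho DihedralLikeGroup.rho_mul_tau DihedralLikeGroup.tau_mul_rho
    DihedralLikeGroup.tau_mul_tau (by decide) DihedralLikeGroup.rho_injective DihedralLikeGroup.tau_injective
    DihedralLikeGroup.rho_ne_tau DihedralLikeGroup.rho_or_tau (by simp)
    _ (z2_zm_zn_onto_z4z4 (by norm_num) (by norm_num)) (by decide) h

end Instances

end Summit.MatrixMultiplication.OmegaCensus
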